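import Literature.AlgebraicTopology.SingularHomology.HurewiczProofs
import Mathlib.GroupTheory.Index
import Mathlib.LinearAlgebra.Finsupp.LinearCombination
import HarnessLib

/-!
# Loop classes span `H₁(X; R)`; surjectivity of `f_*` on `H₁` from a finite-index image on `π₁`

A. Hatcher, *Algebraic Topology* (2002), Thm. 2A.1, surjectivity half, with coefficients in an
arbitrary commutative ring `R` (Hatcher, §2.A with §3.A p. 261 for coefficients): for a
path-connected space `X` with base point `x₀`, every class in `H₁(X; R)` is an `R`-linear
combination of Hurewicz classes `h(γ) = [γ]` of loops `γ` at `x₀`. The tree proves the case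
`R = ℤ` in `HurewiczProofs.lean` (`HurewiczProof.hurewiczOne_surjective`, with additive maps and
`zsmul`); this file redoes the same chain-level argument `R`-linearly:

* `HurewiczProof.extendSingleₗ`, `linearMap_ext_single`: `R`-linear maps out of the singular
  `n`-chains `Cₙ(X; R)` prescribed on elementary chains (through the comparison
  `csingularChainComplex.compIso` with finitely supported functions);
* `HurewiczProof.eChainR`, `d_eChainR`, `phiMapR_eq`: Hatcher's `2`-chains `E σ` with
  `∂ E σ = λ_b - σ + λ_a σ λ_b⁻¹ - λ_a` and the identity `Φ = id + ∂ ∘ E - L ∘ ∂` on `C₁(X; R)`,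
  where `Φ (∑ rᵢ σᵢ) = ∑ rᵢ (λ σᵢ λ⁻¹)` substitutes based loops and `L` cones `0`-chains to `x₀`;
* `HurewiczProof.span_loopClass_eq_top`: **the loop classes `h(γ)`, `γ` a loop at `x₀`, span
  `H₁(X; R)` over `R`**; `singularHomology.linearMap_ext_loopClass`: linear maps out of
  `H₁(X; R)` are determined by their values on loop classes;
* `singularHomology.map_one_surjective_of_index_ne_zero`: for a continuous `f : X → Y` into a
  path-connected `Y` such that `f_* π₁(X, x₀)` has finite index in `π₁(Y, f x₀)`, and a field `F`
  of characteristic zero, **`f_* : H₁(X; F) → H₁(Y; F)` is surjective**: for a loop `δ` at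
  `f x₀` some power `[δ]ᵏ`, `k ≥ 1`, lies in `f_* π₁(X, x₀)`, so `k • h(δ) = f_* h(γ)` and
  `h(δ) ∈ im f_*` (Hatcher Thm. 2A.1 with the naturality of `h`, §2.A p. 166).

The last statement is the form in which covering-space arguments (which control the index of
`f_* π₁` in `π₁`) feed statements about `H₁(-; ℚ)` and, by Kronecker duality
(`KroneckerDualMap.lean`), about `H¹(-; ℚ)` of complex algebraic varieties, e.g. towards
`Literature.AlgebraicGeometry.Motives.isIso_bettiCohomology_map_abelJacobi`.
Everything is proved; the only definitions are the auxiliary chain maps of the proof.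

## References

* A. Hatcher, *Algebraic Topology*, CUP 2002, §2.A Thm. 2A.1 (pp. 166–167), §3.A p. 261.
  [HatcherAT2002]
-/

noncomputable section

-- see the implementation notes of `SingularChainsConcrete.lean` / `HurewiczProofs.lean`: Mathlib's
-- singular chain modules agree with the concrete finitely supported chains up to unfolding
set_option backward.isDefEq.respectTransparency false

open CategoryTheory Set

universe u v w

namespace Literature.AlgebraicTopology.SingularHomology

namespace HurewiczProof

open SingularSimplex singularChainComplex StdSimplex

variable {R : Type v} [CommRing R] {X : Type u} [TopologicalSpace X]

/-! ### `R`-linear maps out of singular chains prescribed on elementary chains -/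

/-- An elementary chain is the scalar multiple of the unit elementary chain: `r σ = r • (1 σ)`.
[folklore] -/
lemma single_eq_smul_one {n : ℕ} (σ : SingularSimplex X n) (r : R) :
    single (R := R) σ r = r • single (R := R) σ (1 : R) := by
  rw [← singleₗ_apply, ← singleₗ_apply, ← map_smul, smul_eq_mul, mul_one]

/-- `R`-linear maps out of Mathlib's singular `n`-chains with coefficients in `R`, prescribed on
the elementary chains: `∑ rᵢ σᵢ ↦ ∑ rᵢ • v σᵢ` (`Finsupp.linearCombination` through the comparison
with concrete chains). [folklore] -/
def extendSingleₗ {n : ℕ} {N : Type w} [AddCommGroup N] [Module R N] (v : SingularSimplex X n → N) :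
    ((singularChainComplex R R X).X n) →ₗ[R] N :=
  (Finsupp.linearCombination R v).comp ((csingularChainComplex.compIso R R X).inv.f n).hom

/-- `extendSingleₗ v (r σ) = r • v σ`. [folklore] -/
@[simp] lemma extendSingleₗ_single {n : ℕ} {N : Type w} [AddCommGroup N] [Module R N]
    (v : SingularSimplex X n → N) (σ : SingularSimplex X n) (r : R) :
    extendSingleₗ v (single (R := R) σ r) = r • v σ := by
  rw [extendSingleₗ, LinearMap.comp_apply]
  change Finsupp.linearCombination R v
    ((csingularChainComplex.compIso R R X).inv.f n (single (R := R) σ r)) = _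
  rw [csingularChainComplex.compIso_inv_f_single, Finsupp.linearCombination_single]

/-- Every singular chain of Mathlib's model is the image of a concrete (finitely supported)
chain. [folklore] -/
lemma exists_compIso_hom_f_eq {n : ℕ} (c : (singularChainComplex R R X).X n) :
    ∃ c' : CChain R X n, (csingularChainComplex.compIso R R X).hom.f n c' = c := by
  refine ⟨(csingularChainComplex.compIso R R X).inv.f n c, ?_⟩
  have h := congrArg (fun φ => φ.f n c) (csingularChainComplex.compIso R R X).inv_hom_id
  simpa only [HomologicalComplex.comp_f, ModuleCat.comp_apply, HomologicalComplex.id_f,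
    ModuleCat.id_apply] using h

/-- Two `R`-linear maps out of the singular `n`-chains agreeing on elementary chains are equal
(`Cₙ(X; R)` is generated by the elementary chains). [folklore] -/
lemma linearMap_ext_single {n : ℕ} {N : Type w} [AddCommGroup N] [Module R N]
    {f g : ((singularChainComplex R R X).X n) →ₗ[R] N}
    (h : ∀ (σ : SingularSimplex X n) (r : R), f (single (R := R) σ r) = g (single (R := R) σ r)) :
    f = g := by
  have hc : f.comp ((csingularChainComplex.compIso R R X).hom.f n).hom =
      g.comp ((csingularChainComplex.compIso R R X).hom.f n).hom := by
    refine Finsupp.lhom_ext fun σ r => ?_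
    change f ((csingularChainComplex.compIso R R X).hom.f n (Finsupp.single σ r)) =
      g ((csingularChainComplex.compIso R R X).hom.f n (Finsupp.single σ r))
    rw [csingularChainComplex.compIso_hom_f_single]
    exact h σ r
  ext c
  obtain ⟨c', rfl⟩ := exists_compIso_hom_f_eq c
  exact LinearMap.congr_fun hc c'

/-- The range of `extendSingleₗ v` is contained in the span of the values of `v`. [folklore] -/
lemma range_extendSingleₗ_le {n : ℕ} {N : Type w} [AddCommGroup N] [Module R N]
    (v : SingularSimplex X n → N) :
    LinearMap.range (extendSingleₗ (R := R) (X := X) v) ≤ Submodule.span R (Set.range v) := by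
  rw [extendSingleₗ, LinearMap.range_comp, ← Finsupp.range_linearCombination]
  exact LinearMap.map_le_range

/-! ### Based loops with ring coefficients: `Φ = id + ∂ ∘ E - L ∘ ∂` -/

variable [PathConnectedSpace X] (x₀ : X)

/-- Hatcher's `2`-chain with `R`-coefficients witnessing `λ_a σ λ_b⁻¹ ∼ λ_a + σ - λ_b` for a singular
`1`-simplex `σ` from `a` to `b` (proof of Thm. 2A.1; the tree's `eChain` with `1 : R` in place
of `1 : ℤ`). [cite: HatcherAT2002, Thm. 2A.1] -/
def eChainR (σ : SingularSimplex X 1) : (singularChainComplex R R X).X 2 :=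
  single (R := R) (ofTrans (lam x₀ (tgt σ)) (lam x₀ (tgt σ)).symm) (1 : R) +
    single (R := R) (const₂ x₀) (1 : R) -
    homotopyChain R R (1 : R) (Path.Homotopy.reflTransSymm (lam x₀ (tgt σ))) -
    single (R := R) (ofTrans σ.toPath (lam x₀ (tgt σ)).symm) (1 : R) -
    single (R := R) (ofTrans (lam x₀ (src σ)) (σ.toPath.trans (lam x₀ (tgt σ)).symm)) (1 : R)

/-- **`∂ E σ = λ_b - σ + (λ_a σ λ_b⁻¹) - λ_a`** with `R`-coefficients (Hatcher, proof of
Thm. 2A.1). [cite: HatcherAT2002, Thm. 2A.1] -/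
lemma d_eChainR (σ : SingularSimplex X 1) :
    (singularChainComplex R R X).d 2 1 (eChainR (R := R) x₀ σ) =
      single (R := R) (ofPath (lam x₀ (tgt σ))) (1 : R) - single (R := R) σ (1 : R) +
        single (R := R) (ofPath (based x₀ σ)) (1 : R) -
          single (R := R) (ofPath (lam x₀ (src σ))) (1 : R) := by
  rw [eChainR, map_sub, map_sub, map_sub, map_add, d_single_ofTrans, d_single_ofTrans,
    d_single_ofTrans, d_single_const₂, d_homotopyChain, ofPath_toPath]
  change _ = _ - _ + single (R := R) (ofPath ((lam x₀ (src σ)).trans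
    (σ.toPath.trans (lam x₀ (tgt σ)).symm))) (1 : R) - _
  abel

/-- The `2`-chain `E` extended linearly: `∑ rᵢ σᵢ ↦ ∑ rᵢ E σᵢ`. [folklore] -/
def eMapR : ((singularChainComplex R R X).X 1) →ₗ[R] ((singularChainComplex R R X).X 2) :=
  extendSingleₗ (eChainR x₀)

/-- The cone to the base point on `0`-chains: `∑ rᵢ [yᵢ] ↦ ∑ rᵢ λ_{yᵢ}`. [folklore] -/
def lMapR : ((singularChainComplex R R X).X 0) →ₗ[R] ((singularChainComplex R R X).X 1) :=
  extendSingleₗ fun ρ => single (R := R) (ofPath (lam x₀ (SingularSimplex.pt ρ))) (1 : R)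

/-- The based-loop substitution `Φ : ∑ rᵢ σᵢ ↦ ∑ rᵢ (λ σᵢ λ⁻¹)` on `1`-chains. [folklore] -/
def phiMapR : ((singularChainComplex R R X).X 1) →ₗ[R] ((singularChainComplex R R X).X 1) :=
  extendSingleₗ fun σ => single (R := R) (ofPath (based x₀ σ)) (1 : R)

omit [PathConnectedSpace X] in
/-- The boundary of an elementary `1`-chain: `∂ (r σ) = r [σ e₁] - r [σ e₀]`. [folklore] -/
lemma d_single_one' (σ : SingularSimplex X 1) (r : R) :
    (singularChainComplex R R X).d 1 0 (single (R := R) σ r) =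
      single (R := R) (ofPoint (tgt σ)) r - single (R := R) (ofPoint (src σ)) r := by
  conv_lhs => rw [← ofPath_toPath σ]
  rw [d_single_ofPath]

/-- **The identity `Φ = id + ∂ ∘ E - L ∘ ∂` on `C₁(X; R)`** (Hatcher, proof of Thm. 2A.1:
`∑ rᵢ λ σᵢ λ⁻¹` is homologous to `∑ rᵢ σᵢ` plus the cone on its boundary). [cite: HatcherAT2002, Thm. 2A.1] -/
lemma phiMapR_eq : phiMapR (R := R) x₀ = LinearMap.id +
    ((singularChainComplex R R X).d 2 1).hom.comp (eMapR x₀) -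
    (lMapR x₀).comp ((singularChainComplex R R X).d 1 0).hom := by
  refine linearMap_ext_single fun σ r => ?_
  change phiMapR x₀ (single (R := R) σ r) = single (R := R) σ r +
    (singularChainComplex R R X).d 2 1 (eMapR x₀ (single (R := R) σ r)) -
      lMapR x₀ ((singularChainComplex R R X).d 1 0 (single (R := R) σ r))
  rw [phiMapR, eMapR, lMapR, extendSingleₗ_single, extendSingleₗ_single, map_smul, d_eChainR,
    d_single_one', map_sub, extendSingleₗ_single, extendSingleₗ_single, pt_ofPoint, pt_ofPoint,
    single_eq_smul_one σ r, smul_sub, smul_add, smul_sub]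
  abel

/-- `Φ` of a cycle is a homologous cycle: `Φ z = z + ∂ (E z)` when `∂ z = 0`. [folklore] -/
lemma phiMapR_cycle (z : (singularChainComplex R R X).X 1)
    (hz : (singularChainComplex R R X).d 1 0 z = 0) :
    phiMapR x₀ z = z + (singularChainComplex R R X).d 2 1 (eMapR x₀ z) := by
  have h := LinearMap.congr_fun (phiMapR_eq (R := R) x₀) z
  simp only [LinearMap.sub_apply, LinearMap.add_apply, LinearMap.id_apply,
    LinearMap.comp_apply] at h
  rw [h]
  change z + _ - lMapR x₀ ((singularChainComplex R R X).d 1 0 z) = _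
  rw [hz, map_zero, sub_zero]

/-- `Φ` takes values in cycles (its values are combinations of loops). [folklore] -/
lemma d_phiMapR (c : (singularChainComplex R R X).X 1) :
    (singularChainComplex R R X).d 1 ((ComplexShape.down ℕ).next 1) (phiMapR x₀ c) = 0 := by
  have h : ((singularChainComplex R R X).d 1 ((ComplexShape.down ℕ).next 1)).hom.comp
      (phiMapR (R := R) x₀) = 0 := by
    refine linearMap_ext_single fun σ r => ?_
    change (singularChainComplex R R X).d 1 ((ComplexShape.down ℕ).next 1)
      (phiMapR x₀ (single (R := R) σ r)) = 0
    rw [phiMapR, extendSingleₗ_single, map_smul, d_single_ofPath_loop, smul_zero]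
  exact LinearMap.congr_fun h c

/-- The chain-level Hurewicz substitution `C₁(X; R) → H₁(X; R)`, `∑ rᵢ σᵢ ↦ ∑ rᵢ h(λ σᵢ λ⁻¹)`.
[folklore] -/
def loopClassMap : ((singularChainComplex R R X).X 1) →ₗ[R] singularHomology R R X 1 :=
  extendSingleₗ fun σ => loopClass R R (1 : R) (based x₀ σ)

/-- **`∑ rᵢ h(λ σᵢ λ⁻¹) = [Φ c]` for every `1`-chain `c = ∑ rᵢ σᵢ`** (by linearity, from the
elementary chains). [folklore] -/
lemma loopClassMap_eq (c : (singularChainComplex R R X).X 1) :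
    loopClassMap x₀ c = homologyCls (phiMapR x₀ c) (d_phiMapR x₀ c) := by
  obtain ⟨c', rfl⟩ := exists_compIso_hom_f_eq c
  induction c' using Finsupp.induction_linear with
  | zero =>
    have h0 : (singularChainComplex R R X).d 1 ((ComplexShape.down ℕ).next 1) 0 = 0 := map_zero _
    rw [map_zero, map_zero, ← homologyCls_zero h0]
    exact homologyCls_congr (map_zero _).symm _ _
  | add a b ha hb =>
    rw [map_add, map_add, ha, hb, ← homologyCls_add _ _ _ _
      (by rw [map_add, d_phiMapR, d_phiMapR, add_zero])]
    exact homologyCls_congr (map_add _ _ _).symm _ _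
  | single σ r =>
    rw [csingularChainComplex.compIso_hom_f_single, loopClassMap, extendSingleₗ_single, loopClass,
      ← homologyCls_smul r _ (d_single_ofPath_loop R R (1 : R) _)
        (by rw [map_smul, d_single_ofPath_loop, smul_zero])]
    exact homologyCls_congr (by rw [phiMapR, extendSingleₗ_single]) _ _

/-- **Loop classes span `H₁(X; R)`** (Hatcher, Thm. 2A.1, surjectivity, with coefficients in a
commutative ring `R`): for a path-connected `X` with base point `x₀`, the `R`-span of the
Hurewicz classes `h(γ) = [γ] ∈ H₁(X; R)` of the loops `γ` at `x₀` is all of `H₁(X; R)`: the class of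
a `1`-cycle `z = ∑ rᵢ σᵢ` equals `[Φ z] = ∑ rᵢ h(λ σᵢ λ⁻¹)`. [cite: HatcherAT2002, Thm. 2A.1] -/
theorem span_loopClass_eq_top :
    Submodule.span R (Set.range fun γ : Path x₀ x₀ => loopClass R R (1 : R) γ) =
      (⊤ : Submodule R (singularHomology R R X 1)) := by
  rw [eq_top_iff]
  rintro y -
  obtain ⟨z, hz, rfl⟩ := homologyCls_surjective y
  have hz' : (singularChainComplex R R X).d 1 0 z = 0 :=
    (d_next_eq_zero_iff (ChainComplex.next_nat_succ 0) z).mp hz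
  -- `[z] = [Φ z]`
  have hcls : homologyCls z hz = homologyCls (phiMapR x₀ z) (d_phiMapR x₀ z) := by
    rw [homologyCls_eq_homologyCls_iff, exists_d_prev_eq_iff (i := 2) (ChainComplex.prev ℕ 1)]
    refine ⟨-eMapR x₀ z, ?_⟩
    rw [map_neg, phiMapR_cycle x₀ z hz']
    abel
  rw [hcls, ← loopClassMap_eq]
  refine Submodule.span_mono ?_ (range_extendSingleₗ_le (R := R) _ (LinearMap.mem_range_self _ z))
  rintro _ ⟨σ, rfl⟩
  exact ⟨based x₀ σ, rfl⟩

end HurewiczProof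

/-! ### Consequences -/

section Consequences

variable {R : Type v} [CommRing R] {X Y : Type u} [TopologicalSpace X] [TopologicalSpace Y]

/-- **Linear maps out of `H₁(X; R)` are determined by their values on loop classes** at a base
point of a path-connected `X` (loop classes span, Hatcher Thm. 2A.1). [cite: HatcherAT2002, Thm. 2A.1] -/
theorem singularHomology.linearMap_ext_loopClass [PathConnectedSpace X] (x₀ : X) {N : Type w}
    [AddCommGroup N] [Module R N] {φ ψ : singularHomology R R X 1 →ₗ[R] N}
    (h : ∀ γ : Path x₀ x₀, φ (loopClass R R (1 : R) γ) = ψ (loopClass R R (1 : R) γ)) : φ = ψ :=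
  LinearMap.ext_on_range (HurewiczProof.span_loopClass_eq_top x₀) h

/-- The Hurewicz homomorphism and induced maps: `h(f ∘ γ) = f_* h(γ)` on `π₁`, i.e.
`h ∘ π₁(f) = H₁(f) ∘ h` (naturality of `h`, Hatcher §2.A; `map_loopClass`). [cite: HatcherAT2002, Thm. 2A.1] -/
theorem hurewiczOne_map (M : Type v) [AddCommGroup M] [Module R M] (m : M) (f : C(X, Y)) (x₀ : X)
    (g : FundamentalGroup X x₀) :
    hurewiczOne R M m (f x₀) (FundamentalGroup.map f x₀ g) =
      Multiplicative.ofAdd (singularHomology.map R M f 1 (Multiplicative.toAdd (hurewiczOne R M m x₀ g))) := by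
  induction g using Quotient.inductionOn with | h γ =>
  change hurewiczOne R M m (f x₀) (FundamentalGroup.fromPath
    (Path.Homotopic.Quotient.mk (γ.map f.continuous))) = Multiplicative.ofAdd
      (singularHomology.map R M f 1 (Multiplicative.toAdd
        (hurewiczOne R M m x₀ (FundamentalGroup.fromPath (Path.Homotopic.Quotient.mk γ)))))
  rw [hurewiczOne_fromPath, hurewiczOne_fromPath, toAdd_ofAdd, map_loopClass]

/-- **`f_* : H₁(X; F) → H₁(Y; F)` is surjective when `f_* π₁(X, x₀)` has finite index in
`π₁(Y, f x₀)`**, for `Y` path connected and `F` a field of characteristic zero: every loop class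
`h(δ)` at `f x₀` satisfies `k • h(δ) = h(δᵏ) = h(f ∘ γ) = f_* h(γ)` for some `k ≥ 1` and some loop
`γ` at `x₀` (a subgroup of finite index contains a positive power of every element), so
`h(δ) = k⁻¹ • f_* h(γ)` lies in the image, and loop classes span `H₁(Y; F)` (Hatcher Thm. 2A.1 and
the naturality of `h`). [cite: HatcherAT2002, Thm. 2A.1] -/
theorem singularHomology.map_one_surjective_of_index_ne_zero [PathConnectedSpace Y]
    (F : Type v) [Field F] [CharZero F] (f : C(X, Y)) (x₀ : X)
    (h : (FundamentalGroup.map f x₀).range.index ≠ 0) :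
    Function.Surjective (singularHomology.map F F f 1) := by
  rw [← LinearMap.range_eq_top (f := (singularHomology.map F F f 1).hom), eq_top_iff,
    ← HurewiczProof.span_loopClass_eq_top (f x₀), Submodule.span_le]
  rintro _ ⟨δ, rfl⟩
  obtain ⟨k, hk, -, hmem⟩ := Subgroup.exists_pow_mem_of_index_ne_zero h
    (FundamentalGroup.fromPath (Path.Homotopic.Quotient.mk δ))
  obtain ⟨g, hg⟩ := hmem
  have hh := congrArg (fun e => Multiplicative.toAdd (hurewiczOne F F (1 : F) (f x₀) e)) hg
  simp only [hurewiczOne_map, toAdd_ofAdd, map_pow, hurewiczOne_fromPath, toAdd_pow,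
    toAdd_ofAdd] at hh
  -- `hh : f_* h(g) = k • h(δ)`
  have hk' : (k : F) ≠ 0 := Nat.cast_ne_zero.mpr hk.ne'
  have : loopClass F F (1 : F) δ = (k : F)⁻¹ • singularHomology.map F F f 1
      (Multiplicative.toAdd (hurewiczOne F F (1 : F) x₀ g)) := by
    rw [hh, ← Nat.cast_smul_eq_nsmul F, smul_smul, inv_mul_cancel₀ hk', one_smul]
  change loopClass F F (1 : F) δ ∈ LinearMap.range (singularHomology.map F F f 1).hom
  rw [this]
  exact Submodule.smul_mem _ _ (LinearMap.mem_range_self _ _)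

end Consequences

end Literature.AlgebraicTopology.SingularHomology

end
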